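import Literature.Geometry.Lorentzian.Hintz2026.TrappingSubprincipalMatrix

/-!
# Hintz 2026, Prop. 8.3 (`PropWETr`): the CLOSING STEP "A + A* ≥ −Cη … when η is small enough" in the kernel —
# for every `ε > 0` ONE inner product `diag(1, η⁻¹, …, η⁻⁹)` in the basis (8.12) makes the symmetric part of the
# printed matrix `A` at least `−ε/2`, uniformly in the parameters `(γ, e^𝓒, 𝔠^𝓒)` on bounded sets

#harness_tags [topic Geometry/Lorentzian]

CITATION HEADER (lean-in-tree rule 2026-08-18).  P. Hintz, *Nonlinear stability of subextremal Kerr black holes*,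
arXiv:2606.28253 **v2** (2026-08-03), bib key `Hintz2026` — an UNREFEREED CLAIM under adjudication in this library
(`Literature.Geometry.Lorentzian.hintz_kerr_stability_subextremal_cauchy` carries its main theorem as
`@[claim "Hintz2026" "under-review"]`); "H l.N" = line N of the v2 TeX source `kerr-stab-r.tex` (md5 2c6513182847).
Written by the audit cell `pub-kerr` (HINTZ-PLAN.md HP-40; GAPS.md C-A24) on top of
`Literature.Geometry.Lorentzian.Hintz2026.TrappingSubprincipalMatrix` (module 68: the printed `A`, `A = P·U·P⁻¹` with `U`
upper triangular and the printed diagonal, `charpoly_A`; its §4 records that the printed "off-diagonal entries of size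
`𝒪(η)`" are of size `𝒪(η^{1/2})`, audit datum SRC-A40) and of `…CarterTetradFrame` §4 (the same closing step for
Lemma 6.4, `lemma64_closing`).  Nothing in this file is an estimate on a function space or a statement about `Γ₀`: it is
the finite-dimensional inequality behind the last paragraph of the proof of Prop. 8.3, valid for all real parameters in
the stated ranges — `(𝔪, a)` do not appear.

## What is printed (H l.7526–7534, v2 PDF p.149; Prop. 8.3 = H l.7395–7403 with (8.9) `EqWETr`)

"Therefore, all eigenvalues of `A` are `≥ 0`. If in the basis (8.12) we define an inner product by
`diag(1, η⁻¹, …, η⁻⁹)` where `η > 0`, then in the orthonormal basis given by rescaling (8.12), the off-diagonal entries of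
`A` are of size `𝒪(η)` as `η → 0`, and thus `A + A* ≥ −Cη` for some `η`-independent `C`. Since the inner product is constant
and `H_{G_b}` acts component-wise, we have `H_{G_b}* = −H_{G_b}`, and therefore,
`σ⁻¹ ½(iS_sub(2L_b) + (iS_sub(2L_b))*) > −ε` when `η` is small enough, as desired." (H l.7530–7534), where
`iS_sub(2L_b) = H_{G_b} + σA` (H l.7499), `γ := (√𝒞/σ)γ^𝓒` "is homogeneous of degree 0 and positive on `Γ₀` (since `σ > 0`
there by [AF, (EqTs3bOTrapSign)])" (H l.7498), `e^𝓒 > 0` small and `γ^𝓒 > 0` (footnote H l.4190), and `𝔠₂ = −g_b⁻¹(𝔠^𝓒, 𝖾⁰) < 0`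
(H l.7526–7529).  Prop. 8.3 itself (H l.7395–7403): "for all `ε > 0` there exists a time-translation-invariant positive
definite fiber inner product on `π*(S²T*)`, homogeneous of degree 0 …, such that (8.9)
`σ⁻¹ (1/2i)(S_sub(2L_b) − S_sub(2L_b)*) < ε` at `Γ₀`".

## What is proved here (all real `γ, e, 𝔠₀, …, 𝔠₃`, `t`, `ε`, `B`)

1. (§1, any dimension `n`) A Gershgorin–Young bound: if `M` is upper triangular with non-negative diagonal and
   `|M_{kl}| ≤ B_{kl}` above the diagonal, then for `0 ≤ t ≤ 1` the RESCALED form `Σ_{k,l} t^{l−k}M_{kl}v_kv_l` (the matrix of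
   `M` in the basis made orthonormal for the weights `t^{−2k}`, cf. module 68 `rescaled_entry`) is `≥ −(t/2)(Σ_{k<l}B_{kl})·|v|²`
   (`rqf_lower_bound`) — the printed mechanism "off-diagonal entries small ⇒ `A + A* ≥ −(small)`", with the honest rate `t =
   η^{1/2}` (SRC-A40: this is what "`𝒪(η)`" must mean; immaterial).
2. (§2) For the explicit `U` of module 68: an explicit bound matrix `Bmat γ C` with `Σ_{k<l} = 24 + 44γC` (`offSum_Bmat`) and
   `|U_{kl}| ≤ Bmat_{kl}` whenever `0 ≤ γ`, `0 ≤ e ≤ 1`, `|𝔠_i| ≤ C` (`U_entry_bounds`, all 45 entries); `U_{kk} ≥ 0` whenever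
   `0 ≤ γ`, `e ≤ 1`, `𝔠₂ ≤ 0` (`U_diag_nonneg` — "all eigenvalues of `A` are `≥ 0`"); the same for `U − 4T` (the variant with the
   sign of the (6.16c) block reversed, cell datum SRC-A16; `UNeg_entry_bounds`, `UNeg_diag_nonneg`).
3. (§3) The printed inner product, scaled by `η⁹` to clear denominators (`η = t²`): `⟨u, u'⟩_t := Σ_k t^{2(9−k)} w_k w'_k`,
   `w = P⁻¹u` the coordinates in the basis (8.12) (`ipE`, `ipE_eq_scaled_printed`); positive definite for `t ≠ 0`
   (`ipE_self_nonneg`, `ipE_definite`); and the dictionary `⟨Au, u⟩_t = Σ_{k,l} t^{l−k}U_{kl}v_kv_l` with `v_k = t^{9−k}w_k`,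
   `⟨u,u⟩_t = |v|²` (`ipE_conj`, `ipE_self`) for ANY `A = P·M·P⁻¹` with `M` upper triangular (module 68 `A_similar`,
   `ANeg_similar`).
4. (§4) **The closing step** `prop83_closing`: for every `ε > 0` and `B ≥ 0`, with the SINGLE choice
   `t = ε/(ε + 24 + 44B²)` (i.e. `η = t²`), at every parameter value with `0 ≤ γ ≤ B`, `0 ≤ e ≤ 1`, `|𝔠_i| ≤ B`, `𝔠₂ ≤ 0`:
   `⟨Au, u⟩_t ≥ −(ε/2)⟨u, u⟩_t` for all `u ∈ ℝ¹⁰` — i.e. `½(A + A*) ≥ −ε/2 > −ε` for this inner product (`prop83_closing_strict`: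
   `> −ε⟨u,u⟩_t` for `u ≠ 0`); and the same for `A⁻ = A − 4N2` (`prop83_closing_neg`; SRC-A16 immaterial, now including the
   closing step).  The hypotheses are WEAKER than the printed ones (`γ > 0`, `0 < e^𝓒 < 1`, `𝔠₂ < 0`); the bound `B` is the
   algebraic stand-in for "`γ`, `𝔠^𝓒` are continuous, `t_*`-independent and homogeneous of degree 0, hence bounded on `Γ₀`",
   which is where the `η`-independence of the printed `C` comes from.

5. (§5) The sign step "`𝔠₂ = −g_b⁻¹(𝔠^𝓒, 𝖾⁰) < 0`" (H l.7526–7529) as the Lorentzian fact it is: in the orthonormal tetrad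
   (6.15), a FUTURE NULL covector pairs POSITIVELY with a PAST TIMELIKE one (`minkPair_pos_of_future_null_of_past_timelike`, a
   reverse Cauchy–Schwarz inequality; `c2_neg`) — the source of the hypothesis `𝔠₂ ≤ 0` above.

NOT formalised (said where used): (8.10) `EqWETrSsub` / (6.13) (`iS_sub(2L_b) = H_{G_b} + σA` as operators on
`π*S²T*`; [HintzPsdoInner]); `H_{G_b}* = −H_{G_b}` for a constant inner product; boundedness of `γ, 𝔠^𝓒` on `Γ₀` and
`𝔠₂ < 0` there (Thm `ThmWCRec`, [AF]); [AF] Definition `DefSSTrapAdm` and Thm `ThmSpHi` (what (8.9) feeds); anything about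
`Γ₀`.  |a|-census (ADEP.md): NIL — `(𝔪, a)` do not occur.  Engine (cell `pub-kerr`, `code/adep1-g22/closing_engine_exact.py`,
standard library, exact rationals): the entry bounds, `offSum = 24 + 44γC`, and the two closing inequalities at random
rational parameters / vectors — PASS; the kernel theorems below are the certificate.
[cite: Hintz2026, Prop. 8.3 `PropWETr` TeX l.7395-7403 with (8.9) `EqWETr` l.7397-7401; proof, closing paragraph l.7526-7534
(v2 PDF p.149); `γ > 0` l.7498; `e^𝓒, γ^𝓒` footnote l.4190; basis (8.12) `EqWGTrSplit2` l.7521-7526 (claims under review; the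
finite-dimensional step is reproduced here with the rate η^{1/2}, audit datum SRC-A40)]
-/

open Matrix Finset

noncomputable section

namespace Literature.Geometry.Lorentzian.Hintz2026.TrappingSubprincipalClosing

open Literature.Geometry.Lorentzian.Hintz2026.CarterTetradFrame
open Literature.Geometry.Lorentzian.Hintz2026.TrappingSubprincipalMatrix

/-! ## 1. A Gershgorin–Young lower bound for the rescaled quadratic form of an upper-triangular matrix -/

/-- `offSum B = Σ_{k<l} B_{kl}`: the sum of the (bounds for the) entries strictly above the diagonal. [folklore] -/
def offSum {n : ℕ} (B : Matrix (Fin n) (Fin n) ℝ) : ℝ := ∑ k, ∑ l, if k < l then B k l else 0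

/-- The RESCALED quadratic form `rqf M t v = Σ_{k,l} t^{l−k} M_{kl} v_k v_l`: the quadratic form of the matrix of `M` in the
basis `f_k = t^k b_k`, orthonormal for the weights `diag(t^{−2k})` — entry `(k,l)` rescaled by `t^{l−k} = η^{(l−k)/2}`
(module 68 `rescaled_entry`). [cite: Hintz2026, TeX l.7530 ("in the orthonormal basis given by rescaling (8.12)"; transcription)] -/
def rqf {n : ℕ} (M : Matrix (Fin n) (Fin n) ℝ) (t : ℝ) (v : Fin n → ℝ) : ℝ :=
  ∑ k : Fin n, ∑ l : Fin n, t ^ ((l : ℕ) - (k : ℕ)) * M k l * v k * v l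

/-- Young: `|m| ≤ b ⇒ m·x·y ≥ −b(x² + y²)/2` (as `4(b(x²+y²)/2 + mxy) = (b+m)(x+y)² + (b−m)(x−y)² ≥ 0`). [folklore] -/
theorem young_aux (m b x y : ℝ) (h1 : -b ≤ m) (h2 : m ≤ b) : -(b * (x ^ 2 + y ^ 2) / 2) ≤ m * x * y := by
  nlinarith [mul_nonneg (by linarith : 0 ≤ b + m) (sq_nonneg (x + y)),
    mul_nonneg (by linarith : 0 ≤ b - m) (sq_nonneg (x - y))]

/-- `v_k² + v_l² ≤ Σ_j v_j²` for `k ≠ l`. [folklore] -/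
theorem pair_sq_le_sum {n : ℕ} (v : Fin n → ℝ) {k l : Fin n} (hkl : k ≠ l) :
    v k ^ 2 + v l ^ 2 ≤ ∑ j, v j ^ 2 := by
  classical
  rw [← Finset.sum_pair (f := fun j => v j ^ 2) hkl]
  exact Finset.sum_le_sum_of_subset_of_nonneg (Finset.subset_univ _) (fun j _ _ => sq_nonneg (v j))

/-- Termwise bound: above the diagonal `t^{l−k}M_{kl}v_kv_l ≥ −(t/2)B_{kl}|v|²` (`0 ≤ t ≤ 1`, `l − k ≥ 1` so `t^{l−k} ≤ t`);
on the diagonal `M_{kk}v_k² ≥ 0`; below it the term vanishes. [folklore] -/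
theorem term_bound {n : ℕ} (M B : Matrix (Fin n) (Fin n) ℝ) (t : ℝ) (v : Fin n → ℝ)
    (hlow : ∀ k l, l < k → M k l = 0) (hdiag : ∀ k, 0 ≤ M k k)
    (hB : ∀ k l, k < l → -B k l ≤ M k l ∧ M k l ≤ B k l) (ht0 : 0 ≤ t) (ht1 : t ≤ 1) (k l : Fin n) :
    -(t / 2 * (if k < l then B k l else 0) * ∑ j, v j ^ 2) ≤ t ^ ((l : ℕ) - (k : ℕ)) * M k l * v k * v l := by
  rcases lt_trichotomy k l with hkl | rfl | hlk
  · rw [if_pos hkl]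
    obtain ⟨h1, h2⟩ := hB k l hkl
    have hBnn : 0 ≤ B k l := by linarith
    have hd : 1 ≤ (l : ℕ) - (k : ℕ) := by have := Fin.lt_def.mp hkl; omega
    have htd : t ^ ((l : ℕ) - (k : ℕ)) ≤ t := by
      calc t ^ ((l : ℕ) - (k : ℕ)) ≤ t ^ 1 := pow_le_pow_of_le_one ht0 ht1 hd
        _ = t := pow_one t
    have htd0 : 0 ≤ t ^ ((l : ℕ) - (k : ℕ)) := pow_nonneg ht0 _
    have hy := young_aux (M k l) (B k l) (v k) (v l) h1 h2
    have hpair := pair_sq_le_sum v (ne_of_lt hkl)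
    have hS : 0 ≤ ∑ j, v j ^ 2 := Finset.sum_nonneg fun j _ => sq_nonneg (v j)
    have step1 : t ^ ((l : ℕ) - (k : ℕ)) * (-(B k l * (v k ^ 2 + v l ^ 2) / 2)) ≤
        t ^ ((l : ℕ) - (k : ℕ)) * (M k l * v k * v l) :=
      mul_le_mul_of_nonneg_left hy htd0
    have hXY : B k l * (v k ^ 2 + v l ^ 2) / 2 ≤ B k l * (∑ j, v j ^ 2) / 2 := by gcongr
    have hX0 : 0 ≤ B k l * (v k ^ 2 + v l ^ 2) / 2 := by positivity
    have step2 : t ^ ((l : ℕ) - (k : ℕ)) * (B k l * (v k ^ 2 + v l ^ 2) / 2) ≤ t * (B k l * (∑ j, v j ^ 2) / 2) :=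
      mul_le_mul htd hXY hX0 ht0
    nlinarith [step1, step2]
  · rw [if_neg (lt_irrefl _), Nat.sub_self, pow_zero, one_mul]
    have h := mul_nonneg (hdiag k) (mul_self_nonneg (v k))
    nlinarith [h]
  · rw [if_neg (not_lt.mpr (le_of_lt hlk)), hlow k l hlk]
    simp

/-- **Gershgorin–Young bound**: for `M` upper triangular with non-negative diagonal and `|M_{kl}| ≤ B_{kl}` (`k < l`), and
`0 ≤ t ≤ 1`: `Σ_{k,l} t^{l−k}M_{kl}v_kv_l ≥ −(t/2)·(Σ_{k<l}B_{kl})·Σ_j v_j²` — "the off-diagonal entries of [the rescaled matrix]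
are small, and thus `A + A* ≥ −C·(small)`", with the rate `t = η^{1/2}`. [cite: Hintz2026, TeX l.7530 (the mechanism; computed
here with the rate η^{1/2}, audit datum SRC-A40)] -/
theorem rqf_lower_bound {n : ℕ} (M B : Matrix (Fin n) (Fin n) ℝ) (t : ℝ) (v : Fin n → ℝ)
    (hlow : ∀ k l, l < k → M k l = 0) (hdiag : ∀ k, 0 ≤ M k k)
    (hB : ∀ k l, k < l → -B k l ≤ M k l ∧ M k l ≤ B k l) (ht0 : 0 ≤ t) (ht1 : t ≤ 1) :
    -(t / 2 * offSum B * ∑ j, v j ^ 2) ≤ rqf M t v := by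
  set S := ∑ j, v j ^ 2
  unfold rqf
  calc -(t / 2 * offSum B * S)
      = ∑ k, ∑ l, -(t / 2 * (if k < l then B k l else 0) * S) := by
        simp only [offSum, Finset.mul_sum, Finset.sum_mul, Finset.sum_neg_distrib]
    _ ≤ ∑ k : Fin n, ∑ l : Fin n, t ^ ((l : ℕ) - (k : ℕ)) * M k l * v k * v l :=
        Finset.sum_le_sum fun k _ => Finset.sum_le_sum fun l _ => term_bound M B t v hlow hdiag hB ht0 ht1 k l

/-! ## 2. The explicit `U` of module 68: entry bounds above the diagonal, non-negative diagonal (also for `U − 4T`) -/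

/-- Entrywise bounds for `U` above the diagonal, valid for `0 ≤ γ`, `0 ≤ e ≤ 1`, `|𝔠_i| ≤ C` (computed here from module 68's
`Umat`: e.g. `|U₄₇| = |2 − 2(1−e)γ𝔠₁| ≤ 2 + 2γC`, `|U₅₇| = |4 − 2(1+e)γ𝔠₁| ≤ 4 + 4γC`). [cite: Hintz2026, TeX l.7521-7530
(computed here)] -/
def Bmat (γ C : ℝ) : Matrix (Fin 10) (Fin 10) ℝ :=
  !![0, 0, 4, 0, 0, 0, 2 * γ * C, 0, 0, 0;
    0, 0, 0, 2, 0, 0, γ * C, 0, 2 * γ * C, 0;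
    0, 0, 0, 0, 2, 2, γ * C, 2 * γ * C, 0, 0;
    0, 0, 0, 0, 0, 0, 0, 2 * γ * C, 2 + 2 * γ * C, 0;
    0, 0, 0, 0, 0, 0, γ * C, 2 + 2 * γ * C, 2 * γ * C, 2 * γ * C;
    0, 0, 0, 0, 0, 0, γ * C, 4 + 4 * γ * C, 2 * γ * C, 2 * γ * C;
    0, 0, 0, 0, 0, 0, 0, 4 + 4 * γ * C, 4 * γ * C, 4 * γ * C;
    0, 0, 0, 0, 0, 0, 0, 0, 0, 2 + 2 * γ * C;
    0, 0, 0, 0, 0, 0, 0, 0, 2 * γ * C, 2 * γ * C;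
    0, 0, 0, 0, 0, 0, 0, 0, 0, 0]

/-- `Σ_{k<l} Bmat_{kl} = 24 + 44γC`. [cite: Hintz2026, TeX l.7530 ("for some η-independent C"; computed here: C may be taken
`(24 + 44γC)/2` per unit of `η^{1/2}`)] -/
theorem offSum_Bmat (γ C : ℝ) : offSum (Bmat γ C) = 24 + 44 * γ * C := by
  simp [offSum, Bmat, Fin.sum_univ_succ]
  ring

/-- "Therefore, all eigenvalues of `A` are `≥ 0`": the diagonal of `U` is non-negative whenever `γ ≥ 0`, `e ≤ 1`, `𝔠₂ ≤ 0`
(printed: `γ > 0`, `e^𝓒` small, `𝔠₂ < 0`). [cite: Hintz2026, TeX l.7526-7530 (reproduced)] -/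
theorem U_diag_nonneg (γ e : ℝ) (c : Fin 4 → ℝ) (hγ : 0 ≤ γ) (he1 : e ≤ 1) (hc2 : c 2 ≤ 0) (k : Fin 10) :
    0 ≤ Umat γ e c k k := by
  have h1 : 0 ≤ -(γ * c 2) := by nlinarith [mul_nonneg hγ (neg_nonneg.mpr hc2)]
  have h2 : 0 ≤ (1 - e) * -(γ * c 2) := mul_nonneg (by linarith) h1
  fin_cases k <;> simp [Umat] <;> nlinarith [h1, h2]

/-- `|U_{kl}| ≤ Bmat_{kl}` for all `k < l` (all 45 entries), given `0 ≤ γ`, `0 ≤ e ≤ 1`, `−C ≤ 𝔠_i ≤ C`.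
[cite: Hintz2026, TeX l.7530 ("off-diagonal entries of A are of size …"; computed here)] -/
theorem U_entry_bounds (γ e C : ℝ) (c : Fin 4 → ℝ) (hγ : 0 ≤ γ) (he0 : 0 ≤ e) (he1 : e ≤ 1)
    (hc : ∀ i, -C ≤ c i ∧ c i ≤ C) :
    ∀ k l : Fin 10, k < l → -Bmat γ C k l ≤ Umat γ e c k l ∧ Umat γ e c k l ≤ Bmat γ C k l := by
  have hC : 0 ≤ C := by linarith [(hc 0).1, (hc 0).2]
  have p0 := hc 0; have p1 := hc 1; have p2 := hc 2; have p3 := hc 3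
  have g0a : 0 ≤ γ * (C - c 0) := mul_nonneg hγ (by linarith [p0.2])
  have g0b : 0 ≤ γ * (C + c 0) := mul_nonneg hγ (by linarith [p0.1])
  have g1a : 0 ≤ γ * (C - c 1) := mul_nonneg hγ (by linarith [p1.2])
  have g1b : 0 ≤ γ * (C + c 1) := mul_nonneg hγ (by linarith [p1.1])
  have g2a : 0 ≤ γ * (C - c 2) := mul_nonneg hγ (by linarith [p2.2])
  have g2b : 0 ≤ γ * (C + c 2) := mul_nonneg hγ (by linarith [p2.1])
  have g3a : 0 ≤ γ * (C - c 3) := mul_nonneg hγ (by linarith [p3.2])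
  have g3b : 0 ≤ γ * (C + c 3) := mul_nonneg hγ (by linarith [p3.1])
  have e0a : 0 ≤ e * (γ * (C - c 0)) := mul_nonneg he0 g0a
  have e0b : 0 ≤ e * (γ * (C + c 0)) := mul_nonneg he0 g0b
  have e1a : 0 ≤ e * (γ * (C - c 1)) := mul_nonneg he0 g1a
  have e1b : 0 ≤ e * (γ * (C + c 1)) := mul_nonneg he0 g1b
  have e2a : 0 ≤ e * (γ * (C - c 2)) := mul_nonneg he0 g2a
  have e2b : 0 ≤ e * (γ * (C + c 2)) := mul_nonneg he0 g2b
  have e3a : 0 ≤ e * (γ * (C - c 3)) := mul_nonneg he0 g3a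
  have e3b : 0 ≤ e * (γ * (C + c 3)) := mul_nonneg he0 g3b
  have f0a : 0 ≤ (1 - e) * (γ * (C - c 0)) := mul_nonneg (by linarith) g0a
  have f0b : 0 ≤ (1 - e) * (γ * (C + c 0)) := mul_nonneg (by linarith) g0b
  have f1a : 0 ≤ (1 - e) * (γ * (C - c 1)) := mul_nonneg (by linarith) g1a
  have f1b : 0 ≤ (1 - e) * (γ * (C + c 1)) := mul_nonneg (by linarith) g1b
  have f2a : 0 ≤ (1 - e) * (γ * (C - c 2)) := mul_nonneg (by linarith) g2a
  have f2b : 0 ≤ (1 - e) * (γ * (C + c 2)) := mul_nonneg (by linarith) g2b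
  have f3a : 0 ≤ (1 - e) * (γ * (C - c 3)) := mul_nonneg (by linarith) g3a
  have f3b : 0 ≤ (1 - e) * (γ * (C + c 3)) := mul_nonneg (by linarith) g3b
  have eC : 0 ≤ e * (γ * C) := mul_nonneg he0 (mul_nonneg hγ hC)
  have fC : 0 ≤ (1 - e) * (γ * C) := mul_nonneg (by linarith) (mul_nonneg hγ hC)
  have gC : 0 ≤ γ * C := mul_nonneg hγ hC
  intro k l hkl
  fin_cases k <;> fin_cases l <;>
    simp only [Fin.reduceFinMk, Fin.isValue, Fin.reduceLT, Umat, Bmat, Matrix.of_apply, Matrix.cons_val] at hkl ⊢ <;>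
    constructor <;> linarith

/-- The same bounds for `U − 4T` (module 68 §5: the basis-(8.12) form of `A⁻ = A − 4N2`, the (6.16c) block with the
reversed sign, cell datum SRC-A16): every constant entry flips its sign (`4 ↦ −4`, `2 ↦ −2`), the bounds are unchanged.
[cite: Hintz2026, TeX l.7530 (variant computed here)] -/
theorem UNeg_entry_bounds (γ e C : ℝ) (c : Fin 4 → ℝ) (hγ : 0 ≤ γ) (he0 : 0 ≤ e) (he1 : e ≤ 1)
    (hc : ∀ i, -C ≤ c i ∧ c i ≤ C) :
    ∀ k l : Fin 10, k < l → -Bmat γ C k l ≤ (Umat γ e c - (4 : ℝ) • TN2) k l ∧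
      (Umat γ e c - (4 : ℝ) • TN2) k l ≤ Bmat γ C k l := by
  have hC : 0 ≤ C := by linarith [(hc 0).1, (hc 0).2]
  have p0 := hc 0; have p1 := hc 1; have p2 := hc 2; have p3 := hc 3
  have g0a : 0 ≤ γ * (C - c 0) := mul_nonneg hγ (by linarith [p0.2])
  have g0b : 0 ≤ γ * (C + c 0) := mul_nonneg hγ (by linarith [p0.1])
  have g1a : 0 ≤ γ * (C - c 1) := mul_nonneg hγ (by linarith [p1.2])
  have g1b : 0 ≤ γ * (C + c 1) := mul_nonneg hγ (by linarith [p1.1])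
  have g2a : 0 ≤ γ * (C - c 2) := mul_nonneg hγ (by linarith [p2.2])
  have g2b : 0 ≤ γ * (C + c 2) := mul_nonneg hγ (by linarith [p2.1])
  have g3a : 0 ≤ γ * (C - c 3) := mul_nonneg hγ (by linarith [p3.2])
  have g3b : 0 ≤ γ * (C + c 3) := mul_nonneg hγ (by linarith [p3.1])
  have e0a : 0 ≤ e * (γ * (C - c 0)) := mul_nonneg he0 g0a
  have e0b : 0 ≤ e * (γ * (C + c 0)) := mul_nonneg he0 g0b
  have e1a : 0 ≤ e * (γ * (C - c 1)) := mul_nonneg he0 g1a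
  have e1b : 0 ≤ e * (γ * (C + c 1)) := mul_nonneg he0 g1b
  have e2a : 0 ≤ e * (γ * (C - c 2)) := mul_nonneg he0 g2a
  have e2b : 0 ≤ e * (γ * (C + c 2)) := mul_nonneg he0 g2b
  have e3a : 0 ≤ e * (γ * (C - c 3)) := mul_nonneg he0 g3a
  have e3b : 0 ≤ e * (γ * (C + c 3)) := mul_nonneg he0 g3b
  have f0a : 0 ≤ (1 - e) * (γ * (C - c 0)) := mul_nonneg (by linarith) g0a
  have f0b : 0 ≤ (1 - e) * (γ * (C + c 0)) := mul_nonneg (by linarith) g0b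
  have f1a : 0 ≤ (1 - e) * (γ * (C - c 1)) := mul_nonneg (by linarith) g1a
  have f1b : 0 ≤ (1 - e) * (γ * (C + c 1)) := mul_nonneg (by linarith) g1b
  have f2a : 0 ≤ (1 - e) * (γ * (C - c 2)) := mul_nonneg (by linarith) g2a
  have f2b : 0 ≤ (1 - e) * (γ * (C + c 2)) := mul_nonneg (by linarith) g2b
  have f3a : 0 ≤ (1 - e) * (γ * (C - c 3)) := mul_nonneg (by linarith) g3a
  have f3b : 0 ≤ (1 - e) * (γ * (C + c 3)) := mul_nonneg (by linarith) g3b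
  have eC : 0 ≤ e * (γ * C) := mul_nonneg he0 (mul_nonneg hγ hC)
  have fC : 0 ≤ (1 - e) * (γ * C) := mul_nonneg (by linarith) (mul_nonneg hγ hC)
  have gC : 0 ≤ γ * C := mul_nonneg hγ hC
  intro k l hkl
  fin_cases k <;> fin_cases l <;>
    simp only [Fin.reduceFinMk, Fin.isValue, Fin.reduceLT, Umat, Bmat, TN2, Matrix.sub_apply, Matrix.smul_apply,
      smul_eq_mul, Matrix.of_apply, Matrix.cons_val] at hkl ⊢ <;>
    constructor <;> linarith

/-- The diagonal of `U − 4T` is that of `U`, hence non-negative under the same hypotheses. [cite: Hintz2026, TeX l.7526-7530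
(variant computed here)] -/
theorem UNeg_diag_nonneg (γ e : ℝ) (c : Fin 4 → ℝ) (hγ : 0 ≤ γ) (he1 : e ≤ 1) (hc2 : c 2 ≤ 0) (k : Fin 10) :
    0 ≤ (Umat γ e c - (4 : ℝ) • TN2) k k := by
  rw [UNeg_diag]; exact U_diag_nonneg γ e c hγ he1 hc2 k

/-! ## 3. The inner product `diag(1, η⁻¹, …, η⁻⁹)` in the basis (8.12), scaled by `η⁹` (`η = t²`), and the dictionary to `A` -/

/-- Coordinates `w = P⁻¹u` of `u ∈ ℝ¹⁰` (components in the splitting (8.11)) with respect to the basis (8.12) `EqWGTrSplit2`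
(the columns of module 68's `Pmat`). [cite: Hintz2026, TeX l.7521-7526 (transcription)] -/
def coordP (u : Fin 10 → ℝ) : Fin 10 → ℝ := Pinv.mulVec u

/-- The weights `t^{2(9−k)} = η^{9−k}`, `k = 0, …, 9` (`η = t²`): `η⁹ ×` the printed `diag(1, η⁻¹, …, η⁻⁹)`.
[cite: Hintz2026, TeX l.7530 (transcription, scaled by η⁹)] -/
def wt (t : ℝ) : Fin 10 → ℝ := ![t ^ 18, t ^ 16, t ^ 14, t ^ 12, t ^ 10, t ^ 8, t ^ 6, t ^ 4, t ^ 2, 1]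

/-- `wt t k = (t^{9−k})²`. [folklore] -/
theorem wt_eq (t : ℝ) (k : Fin 10) : wt t k = (t ^ (9 - (k : ℕ))) ^ 2 := by
  fin_cases k <;> simp [wt] <;> ring

/-- **The inner product of the closing step**: `⟨u, u'⟩_t := Σ_k t^{2(9−k)} w_k w'_k`, `w = P⁻¹u` — `η⁹` times "the inner
product `diag(1, η⁻¹, …, η⁻⁹)` in the basis (8.12)", `η = t²`. [cite: Hintz2026, TeX l.7530 (transcription, scaled by η⁹)] -/
def ipE (t : ℝ) (u u' : Fin 10 → ℝ) : ℝ := ∑ k, wt t k * (coordP u k * coordP u' k)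

/-- `⟨u,u'⟩_t = η⁹ · Σ_k w_k w'_k η^{−k}` with `η = t²` (`t ≠ 0`): the printed inner product up to the positive factor `η⁹`.
[cite: Hintz2026, TeX l.7530 (computed)] -/
theorem ipE_eq_scaled_printed (t : ℝ) (ht : t ≠ 0) (u u' : Fin 10 → ℝ) :
    ipE t u u' = (t ^ 2) ^ 9 * ∑ k : Fin 10, coordP u k * coordP u' k / (t ^ 2) ^ (k : ℕ) := by
  simp only [ipE, wt, Fin.sum_univ_succ, Fin.sum_univ_zero, Matrix.cons_val_zero, Matrix.cons_val_succ,
    Fin.val_zero, Fin.val_succ]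
  field_simp
  ring

/-- Coefficients `v_k = t^{9−k} w_k` of `u` in the `⟨·,·⟩_t`-ORTHONORMAL basis `t^{−(9−k)}b_k` ("the orthonormal basis given by
rescaling (8.12)"). [cite: Hintz2026, TeX l.7530 (transcription)] -/
def vcoord (t : ℝ) (u : Fin 10 → ℝ) : Fin 10 → ℝ := fun k => t ^ (9 - (k : ℕ)) * coordP u k

/-- `⟨u,u⟩_t = Σ_k v_k²`. [folklore] -/
theorem ipE_self (t : ℝ) (u : Fin 10 → ℝ) : ipE t u u = ∑ k, vcoord t u k ^ 2 := by
  unfold ipE vcoord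
  refine Finset.sum_congr rfl fun k _ => ?_
  rw [wt_eq]; ring

/-- `⟨u,u⟩_t ≥ 0`. [folklore] -/
theorem ipE_self_nonneg (t : ℝ) (u : Fin 10 → ℝ) : 0 ≤ ipE t u u := by
  rw [ipE_self]; exact Finset.sum_nonneg fun k _ => sq_nonneg _

/-- `⟨·,·⟩_t` is positive DEFINITE for `t ≠ 0` (`P` is invertible: module 68 `P_mul_Pinv`). [cite: Hintz2026, Prop. 8.3 TeX
l.7397 ("positive definite fiber inner product"; the finite-dimensional part, computed)] -/
theorem ipE_definite (t : ℝ) (ht : t ≠ 0) (u : Fin 10 → ℝ) (h : ipE t u u = 0) : u = 0 := by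
  rw [ipE_self] at h
  have hv : ∀ k, vcoord t u k = 0 := fun k =>
    (pow_eq_zero_iff two_ne_zero).mp
      ((Finset.sum_eq_zero_iff_of_nonneg (fun j _ => sq_nonneg (vcoord t u j))).mp h k (Finset.mem_univ k))
  have hw : coordP u = 0 := by
    funext k
    have hk := hv k
    unfold vcoord at hk
    rcases mul_eq_zero.mp hk with h1 | h1
    · exact absurd h1 (pow_ne_zero _ ht)
    · exact h1
  have hu : u = Pmat.mulVec (coordP u) := by
    unfold coordP; rw [Matrix.mulVec_mulVec, P_mul_Pinv, Matrix.one_mulVec]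
  rw [hu, hw, Matrix.mulVec_zero]

/-- **Dictionary**: for any `A = P·M·P⁻¹` with `M` upper triangular, `⟨Au, u⟩_t = Σ_{k,l} t^{l−k}M_{kl}v_kv_l = rqf M t v` —
the matrix of `A` in the orthonormal rescaled basis has entries `t^{l−k}M_{kl}` (module 68 `rescaled_entry`).
[cite: Hintz2026, TeX l.7530 ("in the orthonormal basis given by rescaling (8.12), the off-diagonal entries of A …"; computed)] -/
theorem ipE_conj (A M : Matrix (Fin 10) (Fin 10) ℝ) (hA : A = Pmat * M * Pinv)
    (hlow : ∀ k l : Fin 10, l < k → M k l = 0) (t : ℝ) (u : Fin 10 → ℝ) :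
    ipE t (A.mulVec u) u = rqf M t (vcoord t u) := by
  have hPA : Pinv * A = M * Pinv := by
    rw [hA, ← Matrix.mul_assoc, ← Matrix.mul_assoc, Pinv_mul_P, Matrix.one_mul]
  have hw : coordP (A.mulVec u) = M.mulVec (coordP u) := by
    unfold coordP; rw [Matrix.mulVec_mulVec, hPA, ← Matrix.mulVec_mulVec]
  unfold ipE rqf
  rw [hw]
  simp only [Matrix.mulVec, dotProduct, Finset.sum_mul, Finset.mul_sum]
  refine Finset.sum_congr rfl fun k _ => Finset.sum_congr rfl fun l _ => ?_
  unfold vcoord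
  rcases lt_or_ge l k with hlk | hkl
  · rw [hlow k l hlk]; ring
  · have hk := k.is_lt
    have hl := l.is_lt
    have hkl' : (k : ℕ) ≤ (l : ℕ) := hkl
    have key : t ^ ((l : ℕ) - (k : ℕ)) * t ^ (9 - (k : ℕ)) * t ^ (9 - (l : ℕ)) = (t ^ (9 - (k : ℕ))) ^ 2 := by
      rw [← pow_add, ← pow_add, ← pow_mul]
      congr 1
      omega
    rw [wt_eq, ← key]
    ring

/-! ## 4. The closing step: `½(A + A*) ≥ −ε/2` for ONE inner product, uniformly on bounded parameter sets -/

/-- **The closing step of Prop. 8.3, for all parameters on bounded sets with ONE inner product**: for `ε > 0`, `B ≥ 0` and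
`t := ε/(ε + 24 + 44B²)` (`η = t²`), at every `(γ, e, 𝔠)` with `0 ≤ γ ≤ B`, `0 ≤ e ≤ 1`, `|𝔠_i| ≤ B`, `𝔠₂ ≤ 0` and for every
`u ∈ ℝ¹⁰`: `⟨Au, u⟩_t ≥ −(ε/2)·⟨u, u⟩_t`, i.e. `½(A + A*) ≥ −ε/2` for `⟨·,·⟩_t` — so, granted `iS_sub(2L_b) = H_{G_b} + σA` and
`H_{G_b}* = −H_{G_b}` (not formalised), `σ⁻¹½(iS_sub(2L_b) + (iS_sub(2L_b))*) = ½(A + A*) ≥ −ε/2 > −ε`.  Printed: "`A + A* ≥ −Cη`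
… `> −ε` when `η` is small enough"; here `η^{1/2} = t` is chosen explicitly. [cite: Hintz2026, Prop. 8.3 `PropWETr`, closing
paragraph of the proof TeX l.7530-7534 (reproduced as a finite-dimensional inequality, rate η^{1/2} per SRC-A40)] -/
theorem prop83_closing (ε B : ℝ) (hε : 0 < ε) (hB : 0 ≤ B) (γ e : ℝ) (c : Fin 4 → ℝ)
    (hγ : 0 ≤ γ) (hγB : γ ≤ B) (he0 : 0 ≤ e) (he1 : e ≤ 1) (hc : ∀ i, -B ≤ c i ∧ c i ≤ B) (hc2 : c 2 ≤ 0)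
    (u : Fin 10 → ℝ) :
    -(ε / 2 * ipE (ε / (ε + 24 + 44 * B ^ 2)) u u) ≤
      ipE (ε / (ε + 24 + 44 * B ^ 2)) ((Amat γ e c).mulVec u) u := by
  set t := ε / (ε + 24 + 44 * B ^ 2) with ht
  have hD : 0 < ε + 24 + 44 * B ^ 2 := by positivity
  have ht0 : 0 ≤ t := by positivity
  have ht1 : t ≤ 1 := by rw [ht, div_le_one hD]; nlinarith [sq_nonneg B]
  have htε : t * (24 + 44 * B ^ 2) ≤ ε := by
    rw [ht, div_mul_eq_mul_div, div_le_iff₀ hD]; nlinarith [sq_nonneg B, hε.le]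
  rw [ipE_conj (Amat γ e c) (Umat γ e c) (A_similar γ e c) (U_lower γ e c) t u, ipE_self]
  have hmain := rqf_lower_bound (Umat γ e c) (Bmat γ B) t (vcoord t u) (U_lower γ e c)
    (U_diag_nonneg γ e c hγ he1 hc2) (U_entry_bounds γ e B c hγ he0 he1 hc) ht0 ht1
  rw [offSum_Bmat] at hmain
  have hS : 0 ≤ ∑ k, vcoord t u k ^ 2 := Finset.sum_nonneg fun k _ => sq_nonneg _
  have hγC : γ * B ≤ B ^ 2 := by nlinarith
  have h1 : t * (24 + 44 * γ * B) ≤ ε := by nlinarith [mul_le_mul_of_nonneg_left hγC ht0]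
  nlinarith [mul_le_mul_of_nonneg_right h1 hS]

/-- The same closing step for `A⁻ = A − 4N2` (the (6.16c) block with the reversed sign; module 68 `AmatNeg`, `ANeg_similar`):
cell datum SRC-A16 is immaterial for Prop. 8.3 INCLUDING its closing step. [cite: Hintz2026, TeX l.7530-7534 (variant computed
here)] -/
theorem prop83_closing_neg (ε B : ℝ) (hε : 0 < ε) (hB : 0 ≤ B) (γ e : ℝ) (c : Fin 4 → ℝ)
    (hγ : 0 ≤ γ) (hγB : γ ≤ B) (he0 : 0 ≤ e) (he1 : e ≤ 1) (hc : ∀ i, -B ≤ c i ∧ c i ≤ B) (hc2 : c 2 ≤ 0)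
    (u : Fin 10 → ℝ) :
    -(ε / 2 * ipE (ε / (ε + 24 + 44 * B ^ 2)) u u) ≤
      ipE (ε / (ε + 24 + 44 * B ^ 2)) ((AmatNeg γ e c).mulVec u) u := by
  set t := ε / (ε + 24 + 44 * B ^ 2) with ht
  have hD : 0 < ε + 24 + 44 * B ^ 2 := by positivity
  have ht0 : 0 ≤ t := by positivity
  have ht1 : t ≤ 1 := by rw [ht, div_le_one hD]; nlinarith [sq_nonneg B]
  have htε : t * (24 + 44 * B ^ 2) ≤ ε := by
    rw [ht, div_mul_eq_mul_div, div_le_iff₀ hD]; nlinarith [sq_nonneg B, hε.le]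
  rw [ipE_conj (AmatNeg γ e c) (Umat γ e c - (4 : ℝ) • TN2) (ANeg_similar γ e c) (UNeg_lower γ e c) t u, ipE_self]
  have hmain := rqf_lower_bound (Umat γ e c - (4 : ℝ) • TN2) (Bmat γ B) t (vcoord t u) (UNeg_lower γ e c)
    (UNeg_diag_nonneg γ e c hγ he1 hc2) (UNeg_entry_bounds γ e B c hγ he0 he1 hc) ht0 ht1
  rw [offSum_Bmat] at hmain
  have hS : 0 ≤ ∑ k, vcoord t u k ^ 2 := Finset.sum_nonneg fun k _ => sq_nonneg _
  have hγC : γ * B ≤ B ^ 2 := by nlinarith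
  have h1 : t * (24 + 44 * γ * B) ≤ ε := by nlinarith [mul_le_mul_of_nonneg_left hγC ht0]
  nlinarith [mul_le_mul_of_nonneg_right h1 hS]

/-- Strict form, as printed ("`> −ε`"): for `u ≠ 0`, `⟨Au, u⟩_t > −ε·⟨u, u⟩_t` (from `≥ −(ε/2)⟨u,u⟩_t` and `⟨u,u⟩_t > 0`).
[cite: Hintz2026, TeX l.7531-7534 (the concluding display; reproduced)] -/
theorem prop83_closing_strict (ε B : ℝ) (hε : 0 < ε) (hB : 0 ≤ B) (γ e : ℝ) (c : Fin 4 → ℝ)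
    (hγ : 0 ≤ γ) (hγB : γ ≤ B) (he0 : 0 ≤ e) (he1 : e ≤ 1) (hc : ∀ i, -B ≤ c i ∧ c i ≤ B) (hc2 : c 2 ≤ 0)
    (u : Fin 10 → ℝ) (hu : u ≠ 0) :
    -(ε * ipE (ε / (ε + 24 + 44 * B ^ 2)) u u) <
      ipE (ε / (ε + 24 + 44 * B ^ 2)) ((Amat γ e c).mulVec u) u := by
  have h := prop83_closing ε B hε hB γ e c hγ hγB he0 he1 hc hc2 u
  have ht : ε / (ε + 24 + 44 * B ^ 2) ≠ 0 := by positivity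
  have hpos : 0 < ipE (ε / (ε + 24 + 44 * B ^ 2)) u u := by
    rcases (ipE_self_nonneg (ε / (ε + 24 + 44 * B ^ 2)) u).lt_or_eq with hlt | heq
    · exact hlt
    · exact absurd (ipE_definite _ ht u heq.symm) hu
  nlinarith

/-! ## 5. The sign step `𝔠₂ = −g_b⁻¹(𝔠^𝓒, 𝖾⁰) < 0` (H l.7526–7529): a future null covector pairs positively with a past timelike one -/

/-- The dual metric in the orthonormal tetrad (6.15) (module 67: `g_b⁻¹ = −ω_(0)² + ω_(1)² + ω_(2)² + ω_(3)²`): for covectors with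
tetrad components `c_μ = c(ω_(μ))`, `w_μ = w(ω_(μ))`, `g_b⁻¹(c, w) = −c₀w₀ + c₁w₁ + c₂w₂ + c₃w₃`. [cite: Hintz2026, eq. (6.15)
`EqWGTrTetrad` TeX l.5991-5997 and GII l.2883 ("the Kerr metric is given by the Minkowski matrix … likewise for the dual metric";
transcription)] -/
def minkPair (c w : Fin 4 → ℝ) : ℝ := -(c 0 * w 0) + c 1 * w 1 + c 2 * w 2 + c 3 * w 3

/-- Lagrange/Cauchy–Schwarz in `ℝ³`: `(c⃗·w⃗)² ≤ |c⃗|²|w⃗|²`. [folklore] -/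
theorem dot3_sq_le (c w : Fin 4 → ℝ) :
    (c 1 * w 1 + c 2 * w 2 + c 3 * w 3) ^ 2 ≤
      (c 1 ^ 2 + c 2 ^ 2 + c 3 ^ 2) * (w 1 ^ 2 + w 2 ^ 2 + w 3 ^ 2) := by
  nlinarith [sq_nonneg (c 1 * w 2 - c 2 * w 1), sq_nonneg (c 1 * w 3 - c 3 * w 1), sq_nonneg (c 2 * w 3 - c 3 * w 2)]

/-- **Reverse Cauchy–Schwarz / the sign of `𝔠₂`**: if `w` is NULL (`g⁻¹(w,w) = 0`) and FUTURE (`w₀ = w(ω_(0)) < 0`, i.e. the vector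
`g⁻¹w` has positive `ω_(0)`-component, `ω_(0)` being future-directed; at `a = 0`, `w₀ = −rσ/√μ`, so this is `σ > 0` — H l.5981,
l.7498) and `c` is TIMELIKE (`g⁻¹(c,c) < 0`) and PAST (`c₀ > 0`), then `g⁻¹(c, w) > 0`.  With `w = 𝖾⁰ = ζ/√𝒞` and `c = 𝔠^𝓒`,
and `g_b⁻¹(𝔠^𝓒, 𝖾⁰) = −𝔠₂` (from (6.16a); module 68 `gInv_c`: `g_b⁻¹(𝔠^𝓒) = (−𝔠₂, 𝔠₁, −𝔠₀, 𝔠₃)`), this is the printed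
"`𝔠₂ = −g_b⁻¹(𝔠^𝓒, 𝖾⁰) < 0`" — the hypothesis `𝔠₂ ≤ 0` of `prop83_closing`.  Not formalised: that `Γ₀` lies in the future
characteristic set and that `𝔠^𝓒` is past timelike (Thm `ThmWCRec`). [cite: Hintz2026, proof of Prop. 8.3 TeX l.7526-7529 ("Recall now
that ζ and thus 𝖾⁰ are future null … Since 𝔠^𝓒 is past timelike …, we thus have 𝔠₂ = −g_b⁻¹(𝔠^𝓒,𝖾⁰) < 0"; the Lorentzian sign
fact reproduced)] -/
theorem minkPair_pos_of_future_null_of_past_timelike (c w : Fin 4 → ℝ)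
    (hw : minkPair w w = 0) (hw0 : w 0 < 0) (hc : minkPair c c < 0) (hc0 : 0 < c 0) :
    0 < minkPair c w := by
  have hwsq : w 1 ^ 2 + w 2 ^ 2 + w 3 ^ 2 = w 0 ^ 2 := by unfold minkPair at hw; nlinarith [hw]
  have hcsq : c 1 ^ 2 + c 2 ^ 2 + c 3 ^ 2 < c 0 ^ 2 := by unfold minkPair at hc; nlinarith [hc]
  have hY : 0 < c 0 * -w 0 := mul_pos hc0 (neg_pos.mpr hw0)
  have hCS := dot3_sq_le c w
  have hlt : (c 1 * w 1 + c 2 * w 2 + c 3 * w 3) ^ 2 < (c 0 * -w 0) ^ 2 := by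
    have hw0sq : 0 < w 0 ^ 2 := by nlinarith [hw0]
    calc (c 1 * w 1 + c 2 * w 2 + c 3 * w 3) ^ 2
        ≤ (c 1 ^ 2 + c 2 ^ 2 + c 3 ^ 2) * (w 1 ^ 2 + w 2 ^ 2 + w 3 ^ 2) := hCS
      _ = (c 1 ^ 2 + c 2 ^ 2 + c 3 ^ 2) * w 0 ^ 2 := by rw [hwsq]
      _ < c 0 ^ 2 * w 0 ^ 2 := mul_lt_mul_of_pos_right hcsq hw0sq
      _ = (c 0 * -w 0) ^ 2 := by ring
  have habs := abs_lt_of_sq_lt_sq hlt hY.le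
  have h1 := (abs_lt.mp habs).1
  unfold minkPair
  nlinarith [h1]

/-- Hence `𝔠₂ := −g_b⁻¹(𝔠^𝓒, 𝖾⁰) < 0` under the printed hypotheses (future null `𝖾⁰`, past timelike `𝔠^𝓒`), in tetrad components.
[cite: Hintz2026, TeX l.7526-7529 (reproduced)] -/
theorem c2_neg (c w : Fin 4 → ℝ) (hw : minkPair w w = 0) (hw0 : w 0 < 0) (hc : minkPair c c < 0) (hc0 : 0 < c 0) :
    -minkPair c w < 0 :=
  neg_neg_of_pos (minkPair_pos_of_future_null_of_past_timelike c w hw hw0 hc hc0)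

end Literature.Geometry.Lorentzian.Hintz2026.TrappingSubprincipalClosing

end
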